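import Summits.SmoothPoincare4.SmoothPoincare4.Theses.EntropyRung
import Literature.Geometry.Riemannian.RoundSphereProofs
import Literature.Geometry.Riemannian.AubinYamabeSphereEuclidean
import Literature.Geometry.GeometricMeasureTheory.AllardIntegralDensityOfLimitsProofs
import Literature.Geometry.Lorentzian.PseudoRiemannianMetricProofs
import HarnessLib

/-!
# The height function on the round sphere: `|∇h|² = 1 − h²`, `□h = −4h` on `S⁴`
(crux stmt-SmoothPoincare4-10871 `EntropyRung.SubcylindricalExistence`, line
`green-blowup-conformal-entropy`, witness helper 2 `helper_sphereHeight` of lead c5's skeleton)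

For the round metric `g = ι^*δ` on Mathlib's unit sphere `Sⁿ ⊂ V` (`roundMetric`,
`Literature/Geometry/Riemannian/RoundSphere.lean`) and a constant vector `c ∈ V`, the height
function `h_c = ⟪c, ι⟫` satisfies, at every `y ∈ Sⁿ`,

* `g⁻¹(dh_c, dh_c)(y) = ‖c‖² − ⟪y, c⟫²` (`gradSq_height_roundMetric`): `♯ dh_c = c^T`, the
  tangential part `c − ⟪y, c⟫ y` of `c` (`sharp_eq_of_forall`; tangent vectors are orthogonal
  to the position vector), so `g⁻¹(dh, dh) = dh(c^T) = ⟪c, c^T⟫`;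
* `□_g h_c (y) = −n ⟪y, c⟫` (`dalembertian_height_roundMetric`): by Allard's height-function
  Laplacian (`Allard1972.exists_meanCurvatureVector`, `inner_normal_meanCurvatureVector`,
  `inner_mvfderiv_meanCurvatureVector` of
  `Literature/Geometry/GeometricMeasureTheory/AllardIntegralDensityOfLimitsProofs.lean`)
  `□ ⟪c, ι⟫ (y) = ⟪c, L⟫` with `L ⊥ dι(T_y Sⁿ)` and
  `⟪y, L⟫ = −divAlong ι ι (y) = −tr_g g = −n` (the position vector is a unit normal of the
  unit sphere); decomposing `c = ⟪y, c⟫ y + c^T` gives `⟪c, L⟫ = −n ⟪y, c⟫`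
  (Simon 1983, §7: `Δ_M x = H⃗`, `= −n x` on the unit sphere).

`helper_sphereHeight` is the registered case `n = 4`, `V = ℝ⁵`, `c = p ∈ S⁴` (`‖p‖ = 1`), with
the inner product written `⟪x, p⟫`. Everything is proved; no definition, no named fact.

References: [Simon1983] §7 (7.6); [ONeill1983] Ch. 3, Def. 3.4, Prop. 3.10 and p. 60.
-/

noncomputable section

-- the registered namespace `Summit.SmoothPoincare4.SmoothPoincare4.Theorems` repeats a component
set_option linter.dupNamespace false

open scoped Manifold ContDiff Topology ENNReal NNReal ContinuousMap RealInnerProductSpace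
open Set Filter MeasureTheory Metric
open Literature.Geometry.Lorentzian Literature.Geometry.Riemannian
open Literature.Geometry.Lorentzian.PseudoRiemannianMetric
open Literature.Geometry.GeometricMeasureTheory

namespace Summit.SmoothPoincare4.SmoothPoincare4.Theorems

section RoundSphereHeight

variable {V : Type*} [NormedAddCommGroup V] [InnerProductSpace ℝ V] {n : ℕ}
  [Fact (Module.finrank ℝ V = n + 1)]

/-- **The tangential part of a constant vector.** For `y ∈ Sⁿ` and `c ∈ V` the vector
`c − ⟪y, c⟫ y` is orthogonal to `y`, hence it is the image `dι_y v₀` of a tangent vector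
`v₀ ∈ T_y Sⁿ` (`exists_mvfderiv_coe_sphere_eq`). [folklore] -/
theorem exists_mvfderiv_coe_sphere_eq_tangentialPart (y : sphere (0 : V) 1) (c : V) :
    ∃ v₀ : TangentSpace (𝓡 n) y,
      mvfderiv (𝓡 n) (Subtype.val : sphere (0 : V) 1 → V) y v₀ = c - ⟪(y : V), c⟫ • (y : V) := by
  refine exists_mvfderiv_coe_sphere_eq (n := n) y ?_
  have hyy : ⟪(y : V), (y : V)⟫ = 1 := by
    rw [real_inner_self_eq_norm_sq, norm_eq_of_mem_sphere, one_pow]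
  rw [inner_sub_right, real_inner_smul_right, hyy, mul_one, sub_self]

/-- **The differential of a height function** `h_c = ⟪c, ι⟫` on the sphere:
`dh_c(w) = ⟪c, dι w⟫`. [folklore] -/
theorem mvfderiv_height_sphere (y : sphere (0 : V) 1) (c : V) (w : TangentSpace (𝓡 n) y) :
    mvfderiv (𝓡 n) (fun z : sphere (0 : V) 1 ↦ ⟪c, (z : V)⟫) y w =
      ⟪c, mvfderiv (𝓡 n) (Subtype.val : sphere (0 : V) 1 → V) y w⟫ :=
  Literature.Geometry.Lorentzian.mvfderiv_inner_const_left c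
    (((contMDiff_coe_sphere (E := V) (n := n) (m := 1)) y).mdifferentiableAt one_ne_zero) w

/-- **`♯ dh_c` is the tangential part of `c`**: if `dι_y v₀ = c − ⟪y, c⟫ y` then
`♯ dh_c (y) = v₀`, since `g(v₀, w) = ⟪c − ⟪y, c⟫ y, dι w⟫ = ⟪c, dι w⟫ = dh_c(w)` for every `w`
(`sharp_eq_of_forall`; O'Neill 1983, Ch. 3, Prop. 3.10 and p. 60).
[cite: ONeill1983, Ch. 3, Prop. 3.10] -/
theorem sharp_mvfderiv_height_roundMetric (y : sphere (0 : V) 1) (c : V)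
    {v₀ : TangentSpace (𝓡 n) y}
    (hv₀ : mvfderiv (𝓡 n) (Subtype.val : sphere (0 : V) 1 → V) y v₀ = c - ⟪(y : V), c⟫ • (y : V)) :
    (roundMetric (n := n) V).sharp y
        (mvfderiv (𝓡 n) (fun z : sphere (0 : V) 1 ↦ ⟪c, (z : V)⟫) y :
          TangentSpace (𝓡 n) y →ₗ[ℝ] ℝ) = v₀ := by
  refine sharp_eq_of_forall _ y _ v₀ fun w ↦ ?_
  rw [ContinuousLinearMap.coe_coe, mvfderiv_height_sphere, roundMetric_val_eq_inner, hv₀,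
    inner_sub_left, real_inner_smul_left, inner_coe_mvfderiv_coe_sphere, mul_zero, sub_zero]

/-- **The gradient square of a height function on the round sphere**:
`g⁻¹(dh_c, dh_c)(y) = ‖c‖² − ⟪y, c⟫²` (`= ‖c^T‖²`, the squared length of the tangential part
of `c`). [folklore] -/
theorem gradSq_height_roundMetric (y : sphere (0 : V) 1) (c : V) :
    (roundMetric (n := n) V).gradSq (fun z : sphere (0 : V) 1 ↦ ⟪c, (z : V)⟫) y =
      ‖c‖ ^ 2 - ⟪(y : V), c⟫ ^ 2 := by
  obtain ⟨v₀, hv₀⟩ := exists_mvfderiv_coe_sphere_eq_tangentialPart (n := n) y c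
  rw [gradSq_eq, sharp_mvfderiv_height_roundMetric y c hv₀, mvfderiv_height_sphere, hv₀,
    inner_sub_right, real_inner_smul_right, real_inner_self_eq_norm_sq, real_inner_comm (y : V) c]
  ring

/-- **The divergence of the position field along the inclusion is the dimension**:
`divAlong ι ι (y) = tr_g g = n` (the pairing `⟪dι v, dι w⟫` is the round metric itself;
`trace_toBilinForm_eq`). For the outward unit normal `ν = y` of the unit sphere this is its
mean curvature `H = n`. [folklore] -/
theorem divAlong_coe_sphere (y : sphere (0 : V) 1) :
    divAlong (I' := 𝓡 n) contMDiff_pullbackBilin_holds (isSpacelikeImmersion_coe_sphere V)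
      (Subtype.val : sphere (0 : V) 1 → V) y = n := by
  have h : derivPairing (𝓡 n) (Subtype.val : sphere (0 : V) 1 → V) Subtype.val y =
      (roundMetric (n := n) V).toBilinForm y := by
    ext v w
    rw [derivPairing_apply, toBilinForm_apply, roundMetric_val_eq_inner]
  rw [divAlong_def, h]
  have ht := trace_toBilinForm_eq (roundMetric (n := n) V) y
  rw [finrank_euclideanSpace_fin] at ht
  exact ht

/-- **The Laplacian of a height function on the round sphere**: `□_g ⟪c, ι⟫ (y) = −n ⟪y, c⟫`
(first eigenfunctions; Simon 1983, §7: `Δ_M x = H⃗`, `= −n x` on the unit sphere). By Allard's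
height-function Laplacian `□ ⟪c, ι⟫ (y) = ⟪c, L⟫` with `L ⊥ dι(T_y Sⁿ)`,
`⟪y, L⟫ = −divAlong ι ι (y) = −n`, and `c = ⟪y, c⟫ y + dι v₀`. [cite: Simon1983, §7 (7.6)] -/
theorem dalembertian_height_roundMetric [(roundMetric (n := n) V).HasLeviCivita]
    (y : sphere (0 : V) 1) (c : V) :
    (roundMetric (n := n) V).dalembertian (fun z : sphere (0 : V) 1 ↦ ⟪c, (z : V)⟫) y =
      -(n : ℝ) * ⟪(y : V), c⟫ := by
  -- `roundMetric V` is by definition the induced metric `ι^*δ` of Allard's lemmas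
  haveI : ((euclideanMetric V).inducedMetric (Subtype.val : sphere (0 : V) 1 → V)
      contMDiff_pullbackBilin_holds (isSpacelikeImmersion_coe_sphere V)).HasLeviCivita := ‹_›
  obtain ⟨L, hL⟩ := Allard1972.exists_meanCurvatureVector (I' := 𝓡 n)
    (hpb := contMDiff_pullbackBilin_holds) (hf := isSpacelikeImmersion_coe_sphere V) y
  have hfd : MDifferentiableAt (𝓡 n) 𝓘(ℝ, V) (Subtype.val : sphere (0 : V) 1 → V) y :=
    ((contMDiff_coe_sphere (E := V) (n := n) (m := 1)) y).mdifferentiableAt one_ne_zero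
  -- the position vector is normal along `ι`, so `⟪y, L⟫ = -divAlong ι ι (y) = -n`
  have hn : ∀ (z : sphere (0 : V) 1) (w : TangentSpace (𝓡 n) z),
      ⟪(z : V), mvfderiv (𝓡 n) (Subtype.val : sphere (0 : V) 1 → V) z w⟫ = 0 :=
    fun z w ↦ inner_coe_mvfderiv_coe_sphere z w
  have hyL : ⟪(y : V), L⟫ = -(n : ℝ) := by
    rw [Allard1972.inner_normal_meanCurvatureVector hL hn hfd, divAlong_coe_sphere]
  -- the tangential part `c - ⟪y, c⟫ y = dι v₀` of `c` is orthogonal to `L`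
  obtain ⟨v₀, hv₀⟩ := exists_mvfderiv_coe_sphere_eq_tangentialPart (n := n) y c
  have h0 : ⟪mvfderiv (𝓡 n) (Subtype.val : sphere (0 : V) 1 → V) y v₀, L⟫ = 0 :=
    Allard1972.inner_mvfderiv_meanCurvatureVector hL v₀
  rw [hv₀, inner_sub_left, real_inner_smul_left, hyL] at h0
  have h1 : (roundMetric (n := n) V).dalembertian (fun z : sphere (0 : V) 1 ↦ ⟪c, (z : V)⟫) y =
      ⟪c, L⟫ := hL c
  rw [h1]
  linarith

end RoundSphereHeight

/-- **Witness helper 2 — the height function on the round `S⁴`**: `h(x) = ⟪x, p⟫` is smooth,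
`|∇h|²_{g_S} = 1 − h²` and `□_{g_S} h = −4h` (first eigenfunction; `Δ_{S⁴} x = −4x`): the case
`n = 4`, `V = ℝ⁵`, `c = p` (`‖p‖ = 1`) of `gradSq_height_roundMetric` and
`dalembertian_height_roundMetric`. [cite: Simon1983, §7 (7.6)] -/
theorem helper_sphereHeight :
    ∀ [Fact (Module.finrank ℝ (EuclideanSpace ℝ (Fin 5)) = 4 + 1)] (p : Metric.sphere (0 :
      EuclideanSpace ℝ (Fin 5)) 1) [(@roundMetric (EuclideanSpace ℝ (Fin 5)) _ _ 4
      _).HasLeviCivita], ContMDiff (𝓡 4) 𝓘(ℝ, ℝ) ∞ (fun x : Metric.sphere (0 : EuclideanSpace ℝ (Fin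
      5)) 1 ↦ ⟪(x : EuclideanSpace ℝ (Fin 5)), (p : EuclideanSpace ℝ (Fin 5))⟫) ∧ (∀ x :
      Metric.sphere (0 : EuclideanSpace ℝ (Fin 5)) 1, (@roundMetric (EuclideanSpace ℝ (Fin 5)) _ _ 4
      _).gradSq (fun x : Metric.sphere (0 : EuclideanSpace ℝ (Fin 5)) 1 ↦ ⟪(x : EuclideanSpace ℝ
      (Fin 5)), (p : EuclideanSpace ℝ (Fin 5))⟫) x = 1 - ⟪(x : EuclideanSpace ℝ (Fin 5)), (p :
      EuclideanSpace ℝ (Fin 5))⟫ ^ 2) ∧ (∀ x : Metric.sphere (0 : EuclideanSpace ℝ (Fin 5)) 1,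
      (@roundMetric (EuclideanSpace ℝ (Fin 5)) _ _ 4 _).dalembertian (fun x : Metric.sphere (0 :
      EuclideanSpace ℝ (Fin 5)) 1 ↦ ⟪(x : EuclideanSpace ℝ (Fin 5)), (p : EuclideanSpace ℝ (Fin
      5))⟫) x = -4 * ⟪(x : EuclideanSpace ℝ (Fin 5)), (p : EuclideanSpace ℝ (Fin 5))⟫) := by
  intro _ p _
  -- `⟪x, p⟫ = ⟪p, x⟫`: the height function of the constant vector `c = p`
  have hfun : (fun x : sphere (0 : EuclideanSpace ℝ (Fin 5)) 1 ↦
      ⟪(x : EuclideanSpace ℝ (Fin 5)), (p : EuclideanSpace ℝ (Fin 5))⟫) =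
      fun z : sphere (0 : EuclideanSpace ℝ (Fin 5)) 1 ↦
        ⟪(p : EuclideanSpace ℝ (Fin 5)), (z : EuclideanSpace ℝ (Fin 5))⟫ :=
    funext fun x ↦ real_inner_comm _ _
  have hp : ‖(p : EuclideanSpace ℝ (Fin 5))‖ = 1 := norm_eq_of_mem_sphere p
  refine ⟨?_, fun x ↦ ?_, fun x ↦ ?_⟩
  · rw [hfun]
    exact Allard1972.contMDiff_heightFunction (contMDiff_coe_sphere (n := 4)) _
  · rw [hfun, gradSq_height_roundMetric, hp, one_pow, real_inner_comm]
  · rw [hfun, dalembertian_height_roundMetric, real_inner_comm]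
    norm_num

end Summit.SmoothPoincare4.SmoothPoincare4.Theorems

end
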